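import Summits.ResolutionOfSingularities.ResolutionOfSingularities.Theorems.WeightedInvariantLocalWeightedDropSurfacePieces
import Summits.ResolutionOfSingularities.ResolutionOfSingularities.Theorems.WeightedInvariantLocalWeightedDropWildTerminalCalculus
import Summits.ResolutionOfSingularities.ResolutionOfSingularities.Theorems.WeightedInvariantLocalWeightedDropSeparableTerminalDoublePointsAux

/-!
# The N = 3 class stubs of skeleton v28 and the crux, from «all singular surface germs are won»

[OURS · L1 W4.3 · chain w43, CHAIN.md v4.4.1 ORDER (o1) AMENDED; stub worker 4] Engine crux `LocalWeightedDrop`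
(stmt-ResolutionOfSingularities-8899), registered skeleton v28 (b8b73808bd522080).  NOT a statement of any manuscript; the game
`CobordantGame.Won` is the programme's own.

(A) FACT-AGNOSTIC LAYER.  From the bare hypothesis
`H3 : ∀ p prime, ∀ k (alg. closed, char p), ∀ f ∈ k⟦x₀,x₁,x₂⟧ singular, Won k 3 f`
(«the N = 3 layer of the local weighted resolution game is won») we derive the five N = 3 CLASS STUBS of v28 with their registered
signatures VERBATIM — S2iM `stub_charTwoInseparableReductionWon`, S2sP `stub_charTwoSeparablePureWon`, S2sM `stub_charTwoSeparableReductionWon`,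
S3πM `stub_wildPurelyInseparableReductionWon`, S3ρ `stub_wildMonicSurfaceReductionWon` — (each concludes `Won k 3 (explicit monic germ)`;
the only work is that the displayed germ is singular) and the CONCLUDER
`localWeightedDrop_of_surfaceGermsWon_of_residuals : H3 → ⟨W4⟩ → ⟨T″⟩ → LocalWeightedDrop` through the landed glue
`localWeightedDrop_of_pieces` (W4 `stub_wildWideApexHigherStartsWon`, T″ `stub_tameWideApexHigherStartsWon` taken as hypotheses
with their registered signatures).  This layer is usable with ANY source of the N = 3 layer.

(B) KEYED TO F-32bR: see the sibling module …TrackCStubInstancesCJSB (`…_of_CJSB`, `localWeightedDrop_of_CJSB_of_residuals`, via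
res-type-088's `TrackC.surfaceGermsWon_of_CJSSequenceB`).  Nothing is keyed to the superseded `CossartJannsenSaito2020EmbeddedSequence`.
The concluder here is a proof of the item WITH EXTRA HYPOTHESES; it closes no stub by name.
-/

set_option linter.dupNamespace false -- mandated namespace of this single-conjunct summit

namespace Summit.ResolutionOfSingularities.ResolutionOfSingularities.Theorems

open Literature.AlgebraicGeometry.Resolution
open Literature.AlgebraicGeometry.Resolution.CobordantGame

namespace TrackC

variable {k : Type} [Field k]

/-! ### The displayed germs of the class stubs are singular -/

/-- `y^d + A₀(x₀,x₁)` with `ord A₀ > d ≥ 2` is a singular germ. [OURS · folklore] -/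
theorem isSingular_pow_add_rename {d : ℕ} (hd : 2 ≤ d) (A₀ : MvPowerSeries (Fin 2) k) (hA₀ : (d : ℕ∞) < A₀.order) :
    IsSingular k (MvPowerSeries.X (Fin.last 2) ^ d + MvPowerSeries.rename (Fin.succAboveEmb (Fin.last 2)) A₀) := by
  classical
  have hd0 : 0 < d := by omega
  set T : Fin d → MvPowerSeries (Fin 2) k := fun j => if (j : ℕ) = 0 then A₀ else 0 with hT
  have hT0 : T ⟨0, hd0⟩ = A₀ := if_pos rfl
  have hTne : ∀ j : Fin d, (j : ℕ) ≠ 0 → T j = 0 := fun j hj => if_neg hj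
  have h := WildUnaryConeMonic.isSingular_monicForm (m := 2) hd T
    (WildTerminal.polyhedron_of_vanish hd0 T hTne (by rw [hT0]; exact hA₀))
  rw [WildTerminal.monicForm_eq_of_vanish hd0 T hTne, hT0] at h
  exact h

/-- `y² + A₀(x₀,x₁) + A₁(x₀,x₁)·y` with `ord A₀ > 2`, `ord A₁ > 1` is a singular germ. [OURS · folklore] -/
theorem isSingular_sq_add_rename_add_mul (A₀ A₁ : MvPowerSeries (Fin 2) k) (hA₀ : (2 : ℕ∞) < A₀.order)
    (hA₁ : (1 : ℕ∞) < A₁.order) :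
    IsSingular k (MvPowerSeries.X (Fin.last 2) ^ 2 +
      (MvPowerSeries.rename (Fin.succAboveEmb (Fin.last 2)) A₀ +
        MvPowerSeries.rename (Fin.succAboveEmb (Fin.last 2)) A₁ * MvPowerSeries.X (Fin.last 2))) := by
  refine SepTerminalDoublePoint.isSingular_dp1 ?_ (fun l => ?_) ?_
  · rw [← MvPowerSeries.coeff_zero_eq_constantCoeff_apply]
    exact MvPowerSeries.coeff_of_lt_order (lt_of_le_of_lt (by simp) hA₀)
  · exact MvPowerSeries.coeff_of_lt_order (lt_of_le_of_lt (by simp) hA₀)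
  · rw [← MvPowerSeries.coeff_zero_eq_constantCoeff_apply]
    exact MvPowerSeries.coeff_of_lt_order (lt_of_le_of_lt (by simp) hA₁)

/-- `ord (x₀^a x₁^b) > 1` when `a + b ≥ 2`. [OURS · folklore] -/
theorem one_lt_order_X_pow_mul_X_pow (a b : ℕ) (hab : 2 ≤ a + b) :
    (1 : ℕ∞) < (MvPowerSeries.X (0 : Fin 2) ^ a * MvPowerSeries.X (1 : Fin 2) ^ b : MvPowerSeries (Fin 2) k).order := by
  have h2 : ((2 : ℕ) : ℕ∞) ≤ (MvPowerSeries.X (0 : Fin 2) ^ a * MvPowerSeries.X (1 : Fin 2) ^ b :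
      MvPowerSeries (Fin 2) k).order := by
    refine MvPowerSeries.nat_le_order fun E hE => ?_
    by_contra hne
    apply hne
    rw [show (MvPowerSeries.X (0 : Fin 2) ^ a * MvPowerSeries.X (1 : Fin 2) ^ b : MvPowerSeries (Fin 2) k) =
        MvPowerSeries.monomial (Finsupp.single 0 a + Finsupp.single 1 b) 1 by
      rw [MvPowerSeries.X_pow_eq, MvPowerSeries.X_pow_eq, MvPowerSeries.monomial_mul_monomial, one_mul],
      MvPowerSeries.coeff_monomial, if_neg]
    rintro rfl
    rw [map_add, Finsupp.degree_single, Finsupp.degree_single] at hE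
    exact absurd hE (by exact_mod_cast (lt_irrefl _ ∘ (lt_of_lt_of_le · hab)))
  exact lt_of_lt_of_le (by exact_mod_cast Nat.one_lt_two) h2

end TrackC

/-! ### (A) The five N = 3 class stubs of v28 from «all singular surface germs are won» -/

/-- S2iM `stub_charTwoInseparableReductionWon` (v28 signature VERBATIM) from H3. [OURS · L1 W4.3] -/
theorem stub_charTwoInseparableReductionWon_of_surfaceGermsWon
    (H3 : ∀ (p : ℕ), p.Prime → ∀ (k : Type) [Field k] [CharP k p] [IsAlgClosed k] (f : MvPowerSeries (Fin 3) k),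
      CobordantGame.IsSingular k f → CobordantGame.Won k 3 f) :
    ∀ (k : Type) [Field k] [CharP k 2] [IsAlgClosed k],
      (∀ m : ℕ, m < 3 → ∀ g : MvPowerSeries (Fin m) k,
        CobordantGame.IsSingular k g → CobordantGame.Won k m g) →
      (∀ (A₀ : MvPowerSeries (Fin 2) k), (2 : ℕ∞) < A₀.order →
        ((∃ (r s : ℕ) (U : MvPowerSeries (Fin 2) k), MvPowerSeries.constantCoeff U ≠ 0 ∧ ¬ (2 ∣ r ∧ 2 ∣ s) ∧
            A₀ = MvPowerSeries.X (0 : Fin 2) ^ r * MvPowerSeries.X (1 : Fin 2) ^ s * U) ∨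
          (∃ (i : Fin 2) (m : ℕ) (g : MvPowerSeries (Fin 2) k), 0 < m ∧ g.order = 1 ∧
            A₀ = MvPowerSeries.X i ^ (2 * m) * g)) →
        CobordantGame.Won k 3 (MvPowerSeries.X (Fin.last 2) ^ 2 +
          MvPowerSeries.rename (Fin.succAboveEmb (Fin.last 2)) A₀)) →
      ∀ (A₀ : MvPowerSeries (Fin 2) k), (2 : ℕ∞) < A₀.order →
        CobordantGame.Won k 3 (MvPowerSeries.X (Fin.last 2) ^ 2 +
          MvPowerSeries.rename (Fin.succAboveEmb (Fin.last 2)) A₀) :=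
  fun k _ _ _ _ _ A₀ hA₀ => H3 2 Nat.prime_two k _ (TrackC.isSingular_pow_add_rename le_rfl A₀ (by exact_mod_cast hA₀))

/-- S2sP `stub_charTwoSeparablePureWon` (v28 signature VERBATIM) from H3. [OURS · L1 W4.3] -/
theorem stub_charTwoSeparablePureWon_of_surfaceGermsWon
    (H3 : ∀ (p : ℕ), p.Prime → ∀ (k : Type) [Field k] [CharP k p] [IsAlgClosed k] (f : MvPowerSeries (Fin 3) k),
      CobordantGame.IsSingular k f → CobordantGame.Won k 3 f) :
    ∀ (k : Type) [Field k] [CharP k 2] [IsAlgClosed k],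
      (∀ m : ℕ, m < 3 → ∀ g : MvPowerSeries (Fin m) k,
        CobordantGame.IsSingular k g → CobordantGame.Won k m g) →
      ∀ (A₀ : MvPowerSeries (Fin 2) k) (a b : ℕ), (2 : ℕ∞) < A₀.order → 2 ≤ a + b →
        CobordantGame.Won k 3 (MvPowerSeries.X (Fin.last 2) ^ 2 +
          (MvPowerSeries.rename (Fin.succAboveEmb (Fin.last 2)) A₀ +
            MvPowerSeries.rename (Fin.succAboveEmb (Fin.last 2)) (MvPowerSeries.X 0 ^ a * MvPowerSeries.X 1 ^ b) *
              MvPowerSeries.X (Fin.last 2))) :=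
  fun k _ _ _ _ A₀ a b hA₀ hab => H3 2 Nat.prime_two k _
    (TrackC.isSingular_sq_add_rename_add_mul A₀ _ hA₀ (TrackC.one_lt_order_X_pow_mul_X_pow a b hab))

/-- S2sM `stub_charTwoSeparableReductionWon` (v28 signature VERBATIM) from H3. [OURS · L1 W4.3] -/
theorem stub_charTwoSeparableReductionWon_of_surfaceGermsWon
    (H3 : ∀ (p : ℕ), p.Prime → ∀ (k : Type) [Field k] [CharP k p] [IsAlgClosed k] (f : MvPowerSeries (Fin 3) k),
      CobordantGame.IsSingular k f → CobordantGame.Won k 3 f) :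
    ∀ (k : Type) [Field k] [CharP k 2] [IsAlgClosed k],
      (∀ m : ℕ, m < 3 → ∀ g : MvPowerSeries (Fin m) k,
        CobordantGame.IsSingular k g → CobordantGame.Won k m g) →
      (∀ (A₀ A₁ : MvPowerSeries (Fin 2) k), (2 : ℕ∞) < A₀.order → (1 : ℕ∞) < A₁.order → A₁ ≠ 0 →
        ((∃ (r s : ℕ) (U B : MvPowerSeries (Fin 2) k), MvPowerSeries.constantCoeff U ≠ 0 ∧ ¬ (2 ∣ r ∧ 2 ∣ s) ∧
            A₀ = MvPowerSeries.X (0 : Fin 2) ^ r * MvPowerSeries.X (1 : Fin 2) ^ s * U ∧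
            A₁ = MvPowerSeries.X (0 : Fin 2) ^ (r / 2) * MvPowerSeries.X (1 : Fin 2) ^ (s / 2) * B) ∨
          (∃ (r s : ℕ) (V W : MvPowerSeries (Fin 2) k), MvPowerSeries.constantCoeff V ≠ 0 ∧
            A₁ = MvPowerSeries.X (0 : Fin 2) ^ r * MvPowerSeries.X (1 : Fin 2) ^ s * V ∧
            A₀ = MvPowerSeries.X (0 : Fin 2) ^ (2 * r) * MvPowerSeries.X (1 : Fin 2) ^ (2 * s) * W) ∨
          (∃ (i : Fin 2) (m : ℕ) (g B : MvPowerSeries (Fin 2) k), 0 < m ∧ g.order = 1 ∧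
            A₀ = MvPowerSeries.X i ^ (2 * m) * g ∧ A₁ = MvPowerSeries.X i ^ m * B)) →
        CobordantGame.Won k 3 (MvPowerSeries.X (Fin.last 2) ^ 2 +
          (MvPowerSeries.rename (Fin.succAboveEmb (Fin.last 2)) A₀ +
            MvPowerSeries.rename (Fin.succAboveEmb (Fin.last 2)) A₁ * MvPowerSeries.X (Fin.last 2)))) →
      ∀ (A₀ A₁ : MvPowerSeries (Fin 2) k), (2 : ℕ∞) < A₀.order → (1 : ℕ∞) < A₁.order → A₁ ≠ 0 →
        CobordantGame.Won k 3 (MvPowerSeries.X (Fin.last 2) ^ 2 +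
          (MvPowerSeries.rename (Fin.succAboveEmb (Fin.last 2)) A₀ +
            MvPowerSeries.rename (Fin.succAboveEmb (Fin.last 2)) A₁ * MvPowerSeries.X (Fin.last 2))) :=
  fun k _ _ _ _ _ A₀ A₁ hA₀ hA₁ _ => H3 2 Nat.prime_two k _ (TrackC.isSingular_sq_add_rename_add_mul A₀ A₁ hA₀ hA₁)

/-- S3πM `stub_wildPurelyInseparableReductionWon` (v28 signature VERBATIM) from H3. [OURS · L1 W4.3] -/
theorem stub_wildPurelyInseparableReductionWon_of_surfaceGermsWon
    (H3 : ∀ (p : ℕ), p.Prime → ∀ (k : Type) [Field k] [CharP k p] [IsAlgClosed k] (f : MvPowerSeries (Fin 3) k),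
      CobordantGame.IsSingular k f → CobordantGame.Won k 3 f) :
    ∀ (p : ℕ), p.Prime → ∀ (k : Type) [Field k] [CharP k p] [IsAlgClosed k],
      (∀ m : ℕ, m < 3 → ∀ g : MvPowerSeries (Fin m) k,
        CobordantGame.IsSingular k g → CobordantGame.Won k m g) →
      ∀ (d : ℕ), (∃ e : ℕ, d = p ^ e) → 2 < d →
      (∀ g : MvPowerSeries (Fin 3) k, CobordantGame.IsSingular k g → g.order < d →
        CobordantGame.Won k 3 g) →
      (∀ g : MvPowerSeries (Fin 3) k, CobordantGame.IsSingular k g → g.order = d →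
        (∃ c : Fin 3 → k, c ≠ 0 ∧ ∀ v : Fin 3 → k,
          CobordantChart.initEval (fun _ : Fin 3 => 1) (v + c) d g =
            CobordantChart.initEval (fun _ : Fin 3 => 1) v d g) →
        (∀ c₁ c₂ : Fin 3 → k,
          (∀ v : Fin 3 → k, CobordantChart.initEval (fun _ : Fin 3 => 1) (v + c₁) d g =
            CobordantChart.initEval (fun _ : Fin 3 => 1) v d g) →
          (∀ v : Fin 3 → k, CobordantChart.initEval (fun _ : Fin 3 => 1) (v + c₂) d g =
            CobordantChart.initEval (fun _ : Fin 3 => 1) v d g) →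
          ∃ α β : k, (α ≠ 0 ∨ β ≠ 0) ∧ α • c₁ + β • c₂ = 0) →
        CobordantGame.Won k 3 g) →
      (∀ (A₀ : MvPowerSeries (Fin 2) k), (d : ℕ∞) < A₀.order →
        ((∃ (r s : ℕ) (U : MvPowerSeries (Fin 2) k), MvPowerSeries.constantCoeff U ≠ 0 ∧ ¬ (d ∣ r ∧ d ∣ s) ∧
            A₀ = MvPowerSeries.X (0 : Fin 2) ^ r * MvPowerSeries.X (1 : Fin 2) ^ s * U) ∨
          (∃ (i : Fin 2) (m : ℕ) (g : MvPowerSeries (Fin 2) k), 0 < m ∧ 0 < g.order ∧ g.order < d ∧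
            A₀ = MvPowerSeries.X i ^ (d * m) * g)) →
        CobordantGame.Won k 3 (MvPowerSeries.X (Fin.last 2) ^ d +
          MvPowerSeries.rename (Fin.succAboveEmb (Fin.last 2)) A₀)) →
      ∀ (A₀ : MvPowerSeries (Fin 2) k), (d : ℕ∞) < A₀.order →
        CobordantGame.Won k 3 (MvPowerSeries.X (Fin.last 2) ^ d +
          MvPowerSeries.rename (Fin.succAboveEmb (Fin.last 2)) A₀) :=
  fun p hp k _ _ _ _ d _ h2d _ _ _ A₀ hA₀ => H3 p hp k _ (TrackC.isSingular_pow_add_rename (by omega) A₀ hA₀)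

/-- S3ρ `stub_wildMonicSurfaceReductionWon` (v28 signature VERBATIM) from H3. [OURS · L1 W4.3] -/
theorem stub_wildMonicSurfaceReductionWon_of_surfaceGermsWon
    (H3 : ∀ (p : ℕ), p.Prime → ∀ (k : Type) [Field k] [CharP k p] [IsAlgClosed k] (f : MvPowerSeries (Fin 3) k),
      CobordantGame.IsSingular k f → CobordantGame.Won k 3 f) :
    ∀ (p : ℕ), p.Prime → ∀ (k : Type) [Field k] [CharP k p] [IsAlgClosed k],
      (∀ m : ℕ, m < 3 → ∀ g : MvPowerSeries (Fin m) k,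
        CobordantGame.IsSingular k g → CobordantGame.Won k m g) →
      ∀ (d : ℕ), p ∣ d → 2 < d →
      (∀ g : MvPowerSeries (Fin 3) k, CobordantGame.IsSingular k g → g.order < d →
        CobordantGame.Won k 3 g) →
      (∀ g : MvPowerSeries (Fin 3) k, CobordantGame.IsSingular k g → g.order = d →
        (∃ c : Fin 3 → k, c ≠ 0 ∧ ∀ v : Fin 3 → k,
          CobordantChart.initEval (fun _ : Fin 3 => 1) (v + c) d g =
            CobordantChart.initEval (fun _ : Fin 3 => 1) v d g) →
        (∀ c₁ c₂ : Fin 3 → k,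
          (∀ v : Fin 3 → k, CobordantChart.initEval (fun _ : Fin 3 => 1) (v + c₁) d g =
            CobordantChart.initEval (fun _ : Fin 3 => 1) v d g) →
          (∀ v : Fin 3 → k, CobordantChart.initEval (fun _ : Fin 3 => 1) (v + c₂) d g =
            CobordantChart.initEval (fun _ : Fin 3 => 1) v d g) →
          ∃ α β : k, (α ≠ 0 ∨ β ≠ 0) ∧ α • c₁ + β • c₂ = 0) →
        CobordantGame.Won k 3 g) →
      ((∃ e : ℕ, d = p ^ e) → ∀ (A₀ : MvPowerSeries (Fin 2) k), (d : ℕ∞) < A₀.order →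
        CobordantGame.Won k 3 (MvPowerSeries.X (Fin.last 2) ^ d +
          MvPowerSeries.rename (Fin.succAboveEmb (Fin.last 2)) A₀)) →
      ∀ A : Fin d → MvPowerSeries (Fin 2) k, (∀ j : Fin d, ((d - (j : ℕ) : ℕ) : ℕ∞) < (A j).order) →
        CobordantGame.Won k 3 (MvPowerSeries.X (Fin.last 2) ^ d +
          ∑ j : Fin d, MvPowerSeries.rename (Fin.succAboveEmb (Fin.last 2)) (A j) * MvPowerSeries.X (Fin.last 2) ^ (j : ℕ)) :=
  fun p hp k _ _ _ _ d _ h2d _ _ _ A hA => H3 p hp k _ (WildUnaryConeMonic.isSingular_monicForm (by omega) A hA)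

/-! ### (A) The crux from H3 and the two `N ≥ 4` residuals -/

/-- THE BANKED CONCLUDER (fact-agnostic): if every singular surface germ is won (H3), then the two `N ≥ 4` residual stubs of v28 —
W4 `stub_wildWideApexHigherStartsWon` and T″ `stub_tameWideApexHigherStartsWon`, taken as hypotheses with their registered signatures —
imply the crux `LocalWeightedDrop` BY NAME (the S2/S3 inputs of the landed glue `localWeightedDrop_of_pieces` conclude `Won k 3 f` for a
singular `f` and are therefore instances of H3).  [OURS · L1 W4.3; proof-of-item WITH EXTRA HYPOTHESES — closes nothing by itself] -/
theorem localWeightedDrop_of_surfaceGermsWon_of_residuals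
    (H3 : ∀ (p : ℕ), p.Prime → ∀ (k : Type) [Field k] [CharP k p] [IsAlgClosed k] (f : MvPowerSeries (Fin 3) k),
      CobordantGame.IsSingular k f → CobordantGame.Won k 3 f)
    (hW4 : ∀ (p : ℕ), p.Prime → ∀ (k : Type) [Field k] [CharP k p] [IsAlgClosed k]
      (n : ℕ), (∀ m : ℕ, m < n + 4 → ∀ g : MvPowerSeries (Fin m) k,
        CobordantGame.IsSingular k g → CobordantGame.Won k m g) →
      ∀ (f : MvPowerSeries (Fin (n + 4)) k), CobordantGame.IsSingular k f →
      (∀ g : MvPowerSeries (Fin (n + 4)) k, CobordantGame.IsSingular k g → g.order < f.order →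
        CobordantGame.Won k (n + 4) g) →
      ∀ (d : ℕ), f.order = d → p ∣ d →
      (∃ ℓ : Fin (n + 4) → k, ∀ i j : Fin (n + 4),
        MvPowerSeries.coeff (Finsupp.single i 1 + Finsupp.single j 1) f =
          MvPowerSeries.coeff (Finsupp.single i 1 + Finsupp.single j 1)
            ((∑ l, MvPowerSeries.C (ℓ l) * MvPowerSeries.X l) ^ 2)) →
      (2 < d → ∃ c₁ c₂ : Fin (n + 4) → k, (∀ α β : k, α • c₁ + β • c₂ = 0 → α = 0 ∧ β = 0) ∧
        (∀ v : Fin (n + 4) → k, CobordantChart.initEval (fun _ : Fin (n + 4) => 1) (v + c₁) d f =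
          CobordantChart.initEval (fun _ : Fin (n + 4) => 1) v d f) ∧
        (∀ v : Fin (n + 4) → k, CobordantChart.initEval (fun _ : Fin (n + 4) => 1) (v + c₂) d f =
          CobordantChart.initEval (fun _ : Fin (n + 4) => 1) v d f)) →
      CobordantGame.Won k (n + 4) f)
    (hT : ∀ (p : ℕ), p.Prime → ∀ (k : Type) [Field k] [CharP k p] [IsAlgClosed k]
    (n : ℕ), (∀ m : ℕ, m < n + 4 → ∀ g : MvPowerSeries (Fin m) k,
      CobordantGame.IsSingular k g → CobordantGame.Won k m g) →
    ∀ (f : MvPowerSeries (Fin (n + 4)) k), CobordantGame.IsSingular k f →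
    (∀ g : MvPowerSeries (Fin (n + 4)) k, CobordantGame.IsSingular k g → g.order < f.order →
      CobordantGame.Won k (n + 4) g) →
    ∀ (d : ℕ), f.order = d → ¬ p ∣ d →
    (∃ ℓ : Fin (n + 4) → k, ∀ i j : Fin (n + 4),
      MvPowerSeries.coeff (Finsupp.single i 1 + Finsupp.single j 1) f =
        MvPowerSeries.coeff (Finsupp.single i 1 + Finsupp.single j 1)
          ((∑ l, MvPowerSeries.C (ℓ l) * MvPowerSeries.X l) ^ 2)) →
    (2 < d → ∃ c₁ c₂ : Fin (n + 4) → k, (∀ α β : k, α • c₁ + β • c₂ = 0 → α = 0 ∧ β = 0) ∧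
      (∀ v : Fin (n + 4) → k, CobordantChart.initEval (fun _ : Fin (n + 4) => 1) (v + c₁) d f =
        CobordantChart.initEval (fun _ : Fin (n + 4) => 1) v d f) ∧
      (∀ v : Fin (n + 4) → k, CobordantChart.initEval (fun _ : Fin (n + 4) => 1) (v + c₂) d f =
        CobordantChart.initEval (fun _ : Fin (n + 4) => 1) v d f)) →
    CobordantGame.Won k (n + 4) f) :
    Summit.ResolutionOfSingularities.ResolutionOfSingularities.Theses.WeightedInvariant.LocalWeightedDrop :=
  localWeightedDrop_of_pieces (fun k _ _ _ _ f hf _ _ _ => H3 2 Nat.prime_two k f hf)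
    (fun p hp k _ _ _ _ f hf _ _ _ _ _ _ _ => H3 p hp k f hf) hW4 hT

end Summit.ResolutionOfSingularities.ResolutionOfSingularities.Theorems
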